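import Mathlib
import Summits.Schanuel.Schanuel.Statement
import Literature.NumberTheory.Transcendental.RoyCriterion
import Summits.Schanuel.Schanuel.Theorems.RoyThesisTyped.Negative.RankStructure
import HarnessLib

/-!
# Schanuel's conjecture: it suffices to prove the ranks along a cofinal sequence

`Summits/Schanuel/Schanuel/Theorems/SoloBlindRankCofinal.lean` (soloist `solo-Schanuel-blind`).

The summit `Schanuel` (`= Literature.Periods.SchanuelConjecture`) is, definitionally, the
conjunction over `n : ℕ` of the rank-`n` statements
`Literature.NumberTheory.Transcendental.SchanuelRank n`, and the ranks form a descending chain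
(`schanuelRank_anti`, already in the tree: adjoin an algebraic number outside the `ℚ`-span).
This file records the cofinality consequences, sorry-free:

* `schanuel_iff_forall_schanuelRank : Schanuel ↔ ∀ n, SchanuelRank n` (`Iff.rfl`);
* `schanuel_iff_eventually : Schanuel ↔ ∀ᶠ n in atTop, SchanuelRank n`;
* `schanuel_iff_of_tendsto : Tendsto f atTop atTop → (Schanuel ↔ ∀ k, SchanuelRank (f k))` —
  it suffices to prove the conjecture along any sequence of ranks tending to infinity
  (e.g. `n = 2^k`, the output format of amplification / tensor-power arguments);
* `not_schanuel_iff_exists_forall_ge : ¬ Schanuel ↔ ∃ N, ∀ n ≥ N, ¬ SchanuelRank n` — a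
  counterexample, if any, persists in all larger ranks, so the open front of the conjecture is the
  single number `sup {n | SchanuelRank n}` (`≥ 1` by Hermite–Lindemann; rank `2` already contains
  the algebraic independence of `e` and `π`).

References: S. Lang, *Introduction to transcendental numbers* (1966), pp. 30–31; D. Roy, *An
arithmetic criterion for the values of the exponential function*, Acta Arith. 97 (2001), Conj. 1
(the rank-`l` format).
-/

noncomputable section

open Filter

namespace Summit.Schanuel.Schanuel.Theorems

open Literature.NumberTheory.Transcendental (SchanuelRank)

/-- The summit is the conjunction of its ranks (definitional). [this work] -/
theorem schanuel_iff_forall_schanuelRank : _root_.Schanuel ↔ ∀ n, SchanuelRank n := Iff.rfl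

/-- Schanuel's conjecture is equivalent to its validity for all sufficiently large ranks.
[this work] -/
theorem schanuel_iff_eventually : _root_.Schanuel ↔ ∀ᶠ n in atTop, SchanuelRank n := by
  refine ⟨fun h => Filter.Eventually.of_forall h, fun h n => ?_⟩
  obtain ⟨N, hN⟩ := Filter.eventually_atTop.1 h
  have hle : n ≤ max n N := le_max_left n N
  have hS : SchanuelRank (max n N) := hN _ (le_max_right n N)
  exact RoyThesisTyped.schanuelRank_anti hle hS

/-- Schanuel's conjecture is equivalent to its validity along any sequence of ranks tending to
infinity (e.g. `n = 2^k`). [this work] -/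
theorem schanuel_iff_of_tendsto {f : ℕ → ℕ} (hf : Tendsto f atTop atTop) :
    _root_.Schanuel ↔ ∀ k, SchanuelRank (f k) := by
  refine ⟨fun h k => h (f k), fun h => schanuel_iff_eventually.2 ?_⟩
  refine Filter.eventually_atTop.2 ⟨0, fun n _ => ?_⟩
  obtain ⟨k, hk⟩ := (Filter.tendsto_atTop.1 hf n).exists
  exact RoyThesisTyped.schanuelRank_anti hk (h k)

/-- A counterexample to Schanuel's conjecture, if any, persists in all larger ranks: the
conjecture fails iff it fails for all sufficiently large ranks. [this work] -/
theorem not_schanuel_iff_exists_forall_ge :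
    ¬ _root_.Schanuel ↔ ∃ N, ∀ n ≥ N, ¬ SchanuelRank n := by
  constructor
  · intro h
    simp only [schanuel_iff_forall_schanuelRank, not_forall] at h
    obtain ⟨N, hN⟩ := h
    exact ⟨N, fun n hn hSn => hN (RoyThesisTyped.schanuelRank_anti hn hSn)⟩
  · rintro ⟨N, hN⟩ h
    exact hN N le_rfl (h N)

end Summit.Schanuel.Schanuel.Theorems
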